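import Summits.HodgeConjecture.HodgeConjecture.Theorems.Q8SymplecticPowersTranscendentalPartTransport
import Literature.AlgebraicGeometry.HodgeTheory.FibrewiseAutomorphismEigenHodgeNumbersConstant
import HarnessLib

/-!
# Route `Q8SymplecticPowers`, crux K1Q — (B) PACKAGING for stub S4 `stub_transcendentalQuaternionicPartQ`: the S4 body at EVERY
# member from the Hodge-number clauses at every member and the monodromy clauses at ONE member

Support file for crux K1Q `VeryGeneralQuaternionCommutatorsInHg` (stmt-HodgeConjecture-24190; `--supports … --as helper`; nothing here
closes an item). Prover seat `hodge-nonav-19716-p2` (g14). Planner p3 (g37) records the S4₄ closing plan as: the monodromy clauses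
(ii) `6 ≤ dim Miv`, ((iii)) «`Miv` irreducible under every finite-index subgroup of `Γ_s`», (iv) `N ≤ ker((τ_s^*)² − 1)` at ONE member
`s₀` (the flat-span certificate, prover 20241-p1's `transcendentalQuaternionicPart_at_member_of_flatSpan`) + the base-point transport (δ)
(`Q8SymplecticPowersTranscendentalPartTransport.transcendentalPart_clauses_transport`, this seat) + the Hodge-number clauses (o), (o′) at
every member (local constancy of the Hodge numbers of the flat splitting `H² = ker((τ^*)²−1) ⊕ ker((τ^*)²+1)`, literature seat) ⇒ S4 at
every member. This file is that implication, in the exact `let`-currency of the stub (skeleton «mechanism-v6∕v7» l.100):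

* `baseChange_eigenspace_le` — `(ker(f − μ)) ⊗ ℂ ≤ ker(f ⊗ ℂ − μ)` (bookkeeping);
* `transcendentalQuaternionicPart_forall_of_member` — **(B)**: under the S6 package binders and `hU`,
  `(∀ s, (o)_s ∧ (o′)_s) → ∀ s₀, [(ii) ∧ ((iii)) ∧ (iv) at s₀] → ∀ s, [(o) ∧ (o′) ∧ (i) ∧ (ii) ∧ ((iii)) ∧ (iv) at s]` — the consequent
  is the body of `stub_transcendentalQuaternionicPartQ` at `s` VERBATIM. Clause (i) `N_ℂ ∩ H^{2,0} = 0` at `s` follows from (iv)_s and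
  (o)_s: `N_ℂ ∩ H^{2,0} ≤ ker((τ_s^*)²_ℂ − 1) ∩ H^{2,0}`, of dimension `0`.
* `transcendentalQuaternionicPart_forall_of_member_at` — **(B′)**: the same with ALL hypotheses at the one member `s₀`
  (`(o)_{s₀} ∧ (o′)_{s₀}` instead of `∀ s, (o)_s ∧ (o′)_s`), the (o)(o′) pair being carried to every member by the literature
  theorem `eigenspace_sq_inf_piece_two_zero_clauses_forall` (`FibrewiseAutomorphismEigenHodgeNumbersConstant`).

HONEST FRAMING: packaging; K1Q is NOT proved (S4's inputs at the member — the counts and the flat-span certificate — and S1, S5, S8 remain);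
nothing here bears on HC ∕ HC_AV.

## References
* [VoisinHodgeII2003] C. Voisin, *Hodge Theory and Complex Algebraic Geometry II*, CUP 2003, §3.1.2.
-/

noncomputable section

set_option linter.dupNamespace false
set_option maxHeartbeats 800000

namespace Summit.HodgeConjecture.HodgeConjecture.Theorems.Q8SymplecticPowersTranscendentalPartOfMember

open scoped TensorProduct
open Summit.HodgeConjecture.HodgeConjecture.Theorems.Q8SymplecticPowersTranscendentalPartTransport
open CategoryTheory CategoryTheory.Limits AlgebraicGeometry
open Literature.AlgebraicGeometry.Motives Literature.AlgebraicGeometry.HodgeTheory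
open Literature.AlgebraicGeometry.HodgeTheory.BettiUniverse Literature.AlgebraicGeometry.HodgeTheory.Q8Family
open Literature.AlgebraicTopology.SingularHomology

/-- The base change of an eigenspace lies in the eigenspace of the base change: `(ker(f − μ)) ⊗ ℂ ≤ ker(f ⊗ ℂ − μ)`. [folklore] -/
theorem baseChange_eigenspace_le {V : Type*} [AddCommGroup V] [Module ℚ V] (f : Module.End ℚ V) (μ : ℚ) :
    (f.eigenspace μ).baseChange ℂ ≤ Module.End.eigenspace (f.baseChange ℂ) (μ : ℂ) := by
  rw [Submodule.baseChange_eq_span, Submodule.span_le]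
  rintro _ ⟨v, hv, rfl⟩
  rw [SetLike.mem_coe, Module.End.mem_eigenspace_iff]
  change (f.baseChange ℂ) ((1 : ℂ) ⊗ₜ[ℚ] v) = (μ : ℂ) • ((1 : ℂ) ⊗ₜ[ℚ] v)
  rw [LinearMap.baseChange_tmul, Module.End.mem_eigenspace_iff.mp hv, TensorProduct.tmul_smul,
    ← algebraMap_smul ℂ μ ((1 : ℂ) ⊗ₜ[ℚ] v), eq_ratCast]

/-- **(B) PACKAGING for S4.** Under the S6 package binders of `stub_transcendentalQuaternionicPartQ` and `hU`: if the Hodge-number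
clauses (o), (o′) hold at every member and the monodromy clauses (ii) ∧ ((iii)) ∧ (iv) hold at one member `s₀`, then the full S4 body
(o) ∧ (o′) ∧ (i) ∧ (ii) ∧ ((iii)) ∧ (iv) holds at every member `s` (transport (δ) for (ii)((iii))(iv); (i) from (iv) and (o)).
[cite: VoisinHodgeII2003, §3.1.2] -/
theorem transcendentalQuaternionicPart_forall_of_member :
    open Literature.AlgebraicGeometry.Motives Literature.AlgebraicGeometry.HodgeTheory Literature.AlgebraicGeometry.HodgeTheory.BettiUniverse Literature.AlgebraicGeometry.HodgeTheory.Q8Family Literature.AlgebraicGeometry.RelativeSpec Literature.AlgebraicGeometry.RelativeSpec.ActionOver CategoryTheory CategoryTheory.Limits MonoidalCategory CartesianMonoidalCategory AlgebraicGeometry in ∀ ⦃e : ℕ⦄, Even e → 4 ≤ e → ∀ (W : (Spec (.of (ParamRing e))).Opens) (𝒳 : SchemeOver ℂ) (π : 𝒳 ⟶ base W) (τ j : 𝒳 ⟶ 𝒳) (ι : (deckChart (fun i => (MvPolynomial.X i : ParamRing e)) ⊗ Over.mk W.ι).left ⟶ 𝒳.left), Nonempty (ComplexPoints (base W)) → ∀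 (hπ : IsSmoothProjectiveFamily π 2), IsQuasiProjectiveOver 𝒳 → IsQuasiProjectiveOver (base W) → AlgebraicGeometry.SmoothOfRelativeDimension (Fintype.card (CIdx e)) (base W).hom → ∀ (hτπ : τ ≫ π = π) (hjπ : j ≫ π = π), τ ≫ τ ≫ τ ≫ τ = 𝟙 𝒳 → j ≫ j = τ ≫ τ → τ ≫ j ≫ τ = j → IsOpenImmersion ι → ι ≫ π.left = (snd (deckChart (fun i => (MvPolynomial.X i : ParamRing e))) (Over.mk W.ι)).left → ((Over.isoMk ((deckAction (fun i => (MvPolynomial.X i : ParamRing e))).aut (QuaternionGroup.a 1)) ((deckAction (fun i => (MvPolynomial.X i : ParamRing e))).aut_comp (QuaternionGroup.a 1))).hom ▷ Over.mk W.ι).left ≫ ι = ι ≫ τ.left → ((Over.isoMk ((deckAction (fun i => (MvPolynomial.X i : ParamRing e))).aut (QuaternionGroup.xa 0)) ((deckAction (fun i => (MvPolynomial.X i : ParamRing e))).aut_comp (QuaternionGroup.xa 0))).hom ▷ Over.mk W.ι).left ≫ ι = ι ≫ j.left → Function.Surjective (snd (deckChart (fun i => (MvPolynomial.X i : ParamRing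 e))) (Over.mk W.ι)).left → ∀ (hU : IsCohomologicallyLocallyTrivialOn π Set.univ), (∀ s : ComplexPoints (base W), let Xs := fiberOver π s; let hXs : IsSmoothProjective 2 Xs := hπ.isSmoothProjective s; let A : bettiCohomology Xs 2 →ₗ[ℚ] bettiCohomology Xs 2 := pull (fiberOverEnd π τ hτπ s) 2; Module.finrank ℂ ↥(Module.End.eigenspace ((A ^ 2).baseChange ℂ) 1 ⊓ (hodge exists_isReal_hodgeModel_holds hXs 2).piece 2 0) = 0 ∧ 0 < Module.finrank ℂ ↥(Module.End.eigenspace ((A ^ 2).baseChange ℂ) (-1) ⊓ (hodge exists_isReal_hodgeModel_holds hXs 2).piece 2 0)) → ∀ (s₀ : ComplexPoints (base W)), (let Xs := fiberOver π s₀; let hXs : IsSmoothProjective 2 Xs := hπ.isSmoothProjective s₀; let A : bettiCohomology Xs 2 →ₗ[ℚ] bettiCohomology Xs 2 := pull (fiberOverEnd π τ hτπ s₀) 2; let Qf : LinearMap.BilinForm ℚ (bettiCohomology Xs 2) := LinearMap.compr₂ (cup Xs 2 2) (tr hXs (2 + 2)); let Γ := ratMonodromyGroup π 2 hU ⟨s₀,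 Set.mem_univ s₀⟩; let N : Submodule ℚ (bettiCohomology Xs 2) := Submodule.span ℚ {x | ∃ Γ' : Subgroup (bettiCohomology Xs 2 ≃ₗ[ℚ] bettiCohomology Xs 2), Γ' ≤ Γ ∧ (Γ'.subgroupOf Γ).FiniteIndex ∧ ∀ γ ∈ Γ', γ x = x}; let Mv : Submodule ℚ (bettiCohomology Xs 2) := Module.End.eigenspace (A ^ 2) (-1) ⊓ Qf.orthogonal N; let Miv : Submodule ℂ (TensorProduct ℚ ℂ (bettiCohomology Xs 2)) := Mv.baseChange ℂ ⊓ Module.End.eigenspace (A.baseChange ℂ) Complex.I; 6 ≤ Module.finrank ℂ Miv ∧ (∀ Γ' : Subgroup (bettiCohomology Xs 2 ≃ₗ[ℚ] bettiCohomology Xs 2), Γ' ≤ Γ → (Γ'.subgroupOf Γ).FiniteIndex → ∀ F : Submodule ℂ (TensorProduct ℚ ℂ (bettiCohomology Xs 2)), F ≤ Miv → (∀ γ ∈ Γ', ∀ x ∈ F, (γ.toLinearMap.baseChange ℂ) x ∈ F) → F = ⊥ ∨ F = Miv) ∧ N ≤ Module.End.eigenspace (A ^ 2) 1) → ∀ (s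 : ComplexPoints (base W)), let Xs := fiberOver π s; let hXs : IsSmoothProjective 2 Xs := hπ.isSmoothProjective s; let A : bettiCohomology Xs 2 →ₗ[ℚ] bettiCohomology Xs 2 := pull (fiberOverEnd π τ hτπ s) 2; let Qf : LinearMap.BilinForm ℚ (bettiCohomology Xs 2) := LinearMap.compr₂ (cup Xs 2 2) (tr hXs (2 + 2)); let Γ := ratMonodromyGroup π 2 hU ⟨s, Set.mem_univ s⟩; let N : Submodule ℚ (bettiCohomology Xs 2) := Submodule.span ℚ {x | ∃ Γ' : Subgroup (bettiCohomology Xs 2 ≃ₗ[ℚ] bettiCohomology Xs 2), Γ' ≤ Γ ∧ (Γ'.subgroupOf Γ).FiniteIndex ∧ ∀ γ ∈ Γ', γ x = x}; let Mv : Submodule ℚ (bettiCohomology Xs 2) := Module.End.eigenspace (A ^ 2) (-1) ⊓ Qf.orthogonal N; let Miv : Submodule ℂ (TensorProduct ℚ ℂ (bettiCohomology Xs 2)) := Mv.baseChange ℂ ⊓ Module.End.eigenspace (A.baseChange ℂ) Complex.I; Module.finrank ℂ ↥(Module.End.eigenspace ((A ^ 2).baseChange ℂ) 1 ⊓ (hodge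 exists_isReal_hodgeModel_holds hXs 2).piece 2 0) = 0 ∧ 0 < Module.finrank ℂ ↥(Module.End.eigenspace ((A ^ 2).baseChange ℂ) (-1) ⊓ (hodge exists_isReal_hodgeModel_holds hXs 2).piece 2 0) ∧ (N.baseChange ℂ ⊓ (hodge exists_isReal_hodgeModel_holds hXs 2).piece 2 0 = ⊥) ∧ 6 ≤ Module.finrank ℂ Miv ∧ (∀ Γ' : Subgroup (bettiCohomology Xs 2 ≃ₗ[ℚ] bettiCohomology Xs 2), Γ' ≤ Γ → (Γ'.subgroupOf Γ).FiniteIndex → ∀ F : Submodule ℂ (TensorProduct ℚ ℂ (bettiCohomology Xs 2)), F ≤ Miv → (∀ γ ∈ Γ', ∀ x ∈ F, (γ.toLinearMap.baseChange ℂ) x ∈ F) → F = ⊥ ∨ F = Miv) ∧ N ≤ Module.End.eigenspace (A ^ 2) 1 := by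
  intro e he h4 W 𝒳 π τ j ι hne hπ hqp hqpW hsm hτπ hjπ hτ4 hj2 hτjτ hιo hιπ hιτ hιj hsurj hU hoo s₀ h0 s Xs hXs A Qf Γ N
    Mv Miv
  have hδ := transcendentalPart_clauses_transport he h4 W 𝒳 π τ j ι hne hπ hqp hqpW hsm hτπ hjπ hτ4 hj2 hτjτ hιo hιπ hιτ
    hιj hsurj hU s₀ s h0
  obtain ⟨hii, hiii, hiv⟩ := hδ
  obtain ⟨ho, ho'⟩ := hoo s
  -- (i) from (iv) and (o)
  haveI := finite (hπ.isSmoothProjective s) 2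
  have hbot : Module.End.eigenspace ((A ^ 2).baseChange ℂ) 1 ⊓
      (hodge exists_isReal_hodgeModel_holds hXs 2).piece 2 0 = ⊥ :=
    Submodule.finrank_eq_zero.mp ho
  have hi : N.baseChange ℂ ⊓ (hodge exists_isReal_hodgeModel_holds hXs 2).piece 2 0 = ⊥ := by
    rw [eq_bot_iff, ← hbot]
    refine inf_le_inf_right _ ((Submodule.baseChange_mono ℂ hiv).trans ?_)
    have h := baseChange_eigenspace_le (A ^ 2) 1
    rwa [Rat.cast_one] at h
  exact ⟨ho, ho', hi, hii, hiii, hiv⟩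

/-- **(B′) PACKAGING for S4, all hypotheses at ONE member.** Under the S6 package binders of `stub_transcendentalQuaternionicPartQ` and
`hU`: if at one member `s₀` the Hodge-number clauses (o) ∧ (o′) AND the monodromy clauses (ii) ∧ ((iii)) ∧ (iv) hold, then the full S4
body holds at every member `s`. The (o)(o′) pair is carried to every member by the literature seat's constancy theorem
`eigenspace_sq_inf_piece_two_zero_clauses_forall` (local constancy of the Hodge numbers of the flat splitting
`H² = ker((τ^*)² − 1) ⊕ ker((τ^*)² + 1)`; the base is irreducible, `(τ_t^*)⁴ = 1` from `quaternionRelations_pull_fiberOverEnd`), then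
`transcendentalQuaternionicPart_forall_of_member`. [cite: VoisinHodgeII2003, §3.1.2] [cite: VoisinHodgeI2002, §9.3.1 Prop. 9.20 and §10.2.1 Thm. 10.3] -/
theorem transcendentalQuaternionicPart_forall_of_member_at :
    open Literature.AlgebraicGeometry.Motives Literature.AlgebraicGeometry.HodgeTheory Literature.AlgebraicGeometry.HodgeTheory.BettiUniverse Literature.AlgebraicGeometry.HodgeTheory.Q8Family Literature.AlgebraicGeometry.RelativeSpec Literature.AlgebraicGeometry.RelativeSpec.ActionOver CategoryTheory CategoryTheory.Limits MonoidalCategory CartesianMonoidalCategory AlgebraicGeometry in ∀ ⦃e : ℕ⦄, Even e → 4 ≤ e → ∀ (W : (Spec (.of (ParamRing e))).Opens) (𝒳 : SchemeOver ℂ) (π : 𝒳 ⟶ base W) (τ j : 𝒳 ⟶ 𝒳) (ι : (deckChart (fun i => (MvPolynomial.X i : ParamRing e)) ⊗ Over.mk W.ι).left ⟶ 𝒳.left), Nonempty (ComplexPoints (base W)) → ∀ (hπ : IsSmoothProjectiveFamily π 2), IsQuasiProjectiveOver 𝒳 → IsQuasiProjectiveOver (base W) → AlgebraicGeometry.SmoothOfRelativeDimension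 (Fintype.card (CIdx e)) (base W).hom → ∀ (hτπ : τ ≫ π = π) (hjπ : j ≫ π = π), τ ≫ τ ≫ τ ≫ τ = 𝟙 𝒳 → j ≫ j = τ ≫ τ → τ ≫ j ≫ τ = j → IsOpenImmersion ι → ι ≫ π.left = (snd (deckChart (fun i => (MvPolynomial.X i : ParamRing e))) (Over.mk W.ι)).left → ((Over.isoMk ((deckAction (fun i => (MvPolynomial.X i : ParamRing e))).aut (QuaternionGroup.a 1)) ((deckAction (fun i => (MvPolynomial.X i : ParamRing e))).aut_comp (QuaternionGroup.a 1))).hom ▷ Over.mk W.ι).left ≫ ι = ι ≫ τ.left → ((Over.isoMk ((deckAction (fun i => (MvPolynomial.X i : ParamRing e))).aut (QuaternionGroup.xa 0)) ((deckAction (fun i => (MvPolynomial.X i : ParamRing e))).aut_comp (QuaternionGroup.xa 0))).hom ▷ Over.mk W.ι).left ≫ ι = ι ≫ j.left → Function.Surjective (snd (deckChart (fun i => (MvPolynomial.X i : ParamRing e))) (Over.mk W.ι)).left → ∀ (hU : IsCohomologicallyLocallyTrivialOn π Set.univ) (s₀ : ComplexPoints (base W)), (let Xs := fiberOver π s₀;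 let hXs : IsSmoothProjective 2 Xs := hπ.isSmoothProjective s₀; let A : bettiCohomology Xs 2 →ₗ[ℚ] bettiCohomology Xs 2 := pull (fiberOverEnd π τ hτπ s₀) 2; Module.finrank ℂ ↥(Module.End.eigenspace ((A ^ 2).baseChange ℂ) 1 ⊓ (hodge exists_isReal_hodgeModel_holds hXs 2).piece 2 0) = 0 ∧ 0 < Module.finrank ℂ ↥(Module.End.eigenspace ((A ^ 2).baseChange ℂ) (-1) ⊓ (hodge exists_isReal_hodgeModel_holds hXs 2).piece 2 0)) → (let Xs := fiberOver π s₀; let hXs : IsSmoothProjective 2 Xs := hπ.isSmoothProjective s₀; let A : bettiCohomology Xs 2 →ₗ[ℚ] bettiCohomology Xs 2 := pull (fiberOverEnd π τ hτπ s₀) 2; let Qf : LinearMap.BilinForm ℚ (bettiCohomology Xs 2) := LinearMap.compr₂ (cup Xs 2 2) (tr hXs (2 + 2)); let Γ := ratMonodromyGroup π 2 hU ⟨s₀, Set.mem_univ s₀⟩; let N : Submodule ℚ (bettiCohomology Xs 2) := Submodule.span ℚ {x | ∃ Γ' : Subgroup (bettiCohomology Xs 2 ≃ₗ[ℚ] bettiCohomology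 Xs 2), Γ' ≤ Γ ∧ (Γ'.subgroupOf Γ).FiniteIndex ∧ ∀ γ ∈ Γ', γ x = x}; let Mv : Submodule ℚ (bettiCohomology Xs 2) := Module.End.eigenspace (A ^ 2) (-1) ⊓ Qf.orthogonal N; let Miv : Submodule ℂ (TensorProduct ℚ ℂ (bettiCohomology Xs 2)) := Mv.baseChange ℂ ⊓ Module.End.eigenspace (A.baseChange ℂ) Complex.I; 6 ≤ Module.finrank ℂ Miv ∧ (∀ Γ' : Subgroup (bettiCohomology Xs 2 ≃ₗ[ℚ] bettiCohomology Xs 2), Γ' ≤ Γ → (Γ'.subgroupOf Γ).FiniteIndex → ∀ F : Submodule ℂ (TensorProduct ℚ ℂ (bettiCohomology Xs 2)), F ≤ Miv → (∀ γ ∈ Γ', ∀ x ∈ F, (γ.toLinearMap.baseChange ℂ) x ∈ F) → F = ⊥ ∨ F = Miv) ∧ N ≤ Module.End.eigenspace (A ^ 2) 1) → ∀ (s : ComplexPoints (base W)), let Xs := fiberOver π s; let hXs : IsSmoothProjective 2 Xs := hπ.isSmoothProjective s; let A : bettiCohomology Xs 2 →ₗ[ℚ] bettiCohomology Xs 2 :=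 pull (fiberOverEnd π τ hτπ s) 2; let Qf : LinearMap.BilinForm ℚ (bettiCohomology Xs 2) := LinearMap.compr₂ (cup Xs 2 2) (tr hXs (2 + 2)); let Γ := ratMonodromyGroup π 2 hU ⟨s, Set.mem_univ s⟩; let N : Submodule ℚ (bettiCohomology Xs 2) := Submodule.span ℚ {x | ∃ Γ' : Subgroup (bettiCohomology Xs 2 ≃ₗ[ℚ] bettiCohomology Xs 2), Γ' ≤ Γ ∧ (Γ'.subgroupOf Γ).FiniteIndex ∧ ∀ γ ∈ Γ', γ x = x}; let Mv : Submodule ℚ (bettiCohomology Xs 2) := Module.End.eigenspace (A ^ 2) (-1) ⊓ Qf.orthogonal N; let Miv : Submodule ℂ (TensorProduct ℚ ℂ (bettiCohomology Xs 2)) := Mv.baseChange ℂ ⊓ Module.End.eigenspace (A.baseChange ℂ) Complex.I; Module.finrank ℂ ↥(Module.End.eigenspace ((A ^ 2).baseChange ℂ) 1 ⊓ (hodge exists_isReal_hodgeModel_holds hXs 2).piece 2 0) = 0 ∧ 0 < Module.finrank ℂ ↥(Module.End.eigenspace ((A ^ 2).baseChange ℂ) (-1) ⊓ (hodge exists_isReal_hodgeModel_holds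 hXs 2).piece 2 0) ∧ (N.baseChange ℂ ⊓ (hodge exists_isReal_hodgeModel_holds hXs 2).piece 2 0 = ⊥) ∧ 6 ≤ Module.finrank ℂ Miv ∧ (∀ Γ' : Subgroup (bettiCohomology Xs 2 ≃ₗ[ℚ] bettiCohomology Xs 2), Γ' ≤ Γ → (Γ'.subgroupOf Γ).FiniteIndex → ∀ F : Submodule ℂ (TensorProduct ℚ ℂ (bettiCohomology Xs 2)), F ≤ Miv → (∀ γ ∈ Γ', ∀ x ∈ F, (γ.toLinearMap.baseChange ℂ) x ∈ F) → F = ⊥ ∨ F = Miv) ∧ N ≤ Module.End.eigenspace (A ^ 2) 1 := by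
  intro e he h4 W 𝒳 π τ j ι hne hπ hqp hqpW hsm hτπ hjπ hτ4 hj2 hτjτ hιo hιπ hιτ hιj hsurj hU s₀ ho₀ h0 s
  haveI : IrreducibleSpace (base W).left := by
    obtain ⟨t₀⟩ := hne
    haveI : IrreducibleSpace (Spec (CommRingCat.of (ParamRing e))) :=
      inferInstanceAs (IrreducibleSpace (PrimeSpectrum (ParamRing e)))
    change IrreducibleSpace W
    exact isIrreducible_iff_irreducibleSpace.mp ⟨⟨W.ι t₀.pt, by rw [← Scheme.Opens.range_ι]; exact ⟨t₀.pt, rfl⟩⟩,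
      (PreirreducibleSpace.isPreirreducible_univ (X := Spec (CommRingCat.of (ParamRing e)))).open_subset W.isOpen
        (Set.subset_univ _)⟩
  have hA4 : ∀ t : ComplexPoints (base W), (pull (fiberOverEnd π τ hτπ t) 2) ^ 4 = 1 := fun t =>
    (quaternionRelations_pull_fiberOverEnd π hτπ hjπ hτ4 hj2 hτjτ t 2).1
  have ho := eigenspace_sq_inf_piece_two_zero_clauses_forall exists_isReal_hodgeModel_holds π (Fintype.card (CIdx e)) hπ
    hqp hqpW hU τ hτπ hA4 s₀ ho₀
  exact transcendentalQuaternionicPart_forall_of_member he h4 W 𝒳 π τ j ι hne hπ hqp hqpW hsm hτπ hjπ hτ4 hj2 hτjτ hιo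
    hιπ hιτ hιj hsurj hU ho s₀ h0 s

end Summit.HodgeConjecture.HodgeConjecture.Theorems.Q8SymplecticPowersTranscendentalPartOfMember

end
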